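import Literature.MathematicalPhysics.QuantumLattice.VariationalPrincipleBogoliubovInequality
import Literature.MathematicalPhysics.QuantumLattice.TranslationInvariantGroundStatesAreMeanEnergyMinimisers
import Mathlib.Algebra.Order.Chebyshev
import Mathlib.Tactic.NoncommRing
import HarnessLib

/-!
# The Mermin–Wagner / Klein–Landau–Shucker criterion for translation-invariant equilibrium states: charged local observables
# have zero expectation once the conserved charge admits generators with small double commutators

Topic `Literature/MathematicalPhysics/QuantumLattice` (family `hubbard`; third file of the series `VariationalPrincipleLocalKMSRows`
→ `VariationalPrincipleBogoliubovInequality` → this file → the two-dimensional theorem).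

**Klein–Landau–Shucker** (J. Stat. Phys. 26 (1981) 505) prove that in one and two dimensions every equilibrium (KMS) state of a
quantum lattice system with a continuous internal symmetry is invariant under the symmetry, by Bogoliubov's inequality for KMS
states applied to the generators `Σ_x f(x) q_x` of the symmetry restricted to large boxes with slowly varying `f` (the
Mermin–Wagner argument, Mermin–Wagner 1966, Hohenberg 1967; Fröhlich–Pfister 1981 by relative entropy). This file proves the
DIMENSION-INDEPENDENT half of that argument for translation-invariant solutions of the variational principle of an even
finite-range lattice-fermion interaction `Ψ` on `ℤ^d` (for which `VariationalPrincipleBogoliubovInequality` supplies Bogoliubov's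
inequality in infinite volume):

* §1 `InfVolFermionState.IsTranslationInvariant.expect_eq_zero_of_small_double_commutators` — ABSTRACT CRITERION: if a local `O`
  satisfies `[C, Õ] = κÕ`, `κ ≠ 0`, for local `C` whose double commutators `[C̃ᴴ,[H_{Λ'},C̃]]` have arbitrarily small norm, then
  `ω(O) = 0` for every translation-invariant solution `ω` of the variational principle at `β ≥ 0`;
* §2 ON-SITE CHARGES: `chargeAt q Λ x = q_x` (the translate to `x ∈ Λ` of an observable `q ∈ 𝔄_{{0}}`), `chargeSum q Λ = Σ_{x∈Λ} q_x`,
  `weightedCharge q f Λ = Σ_{x∈Λ} f(x) q_x`, with isotony, evenness, Hermiticity and graded-locality bookkeeping, and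
  `weightedCharge_commutator_fermionEmbed`: `[Σ_{x∈Λ₁} f(x)q_x, Õ] = Γ[Q_Λ, O]` when `f ≡ 1` on `Λ ⊆ Λ₁`;
* §3 `norm_doubleCommutator_weightedCharge_localHamiltonian_le` — THE DOUBLE-COMMUTATOR BOUND: if every term `Φ(Z)` commutes with
  `Q_Z = Σ_{x∈Z} q_x` (the interaction conserves the charge) and `q` is even, then for every real `f` and ANY constants `c_Z`,
  `‖[W,[H_{Λ'},W]]‖ ≤ 4‖q‖² Σ_{Z⊆Λ'} ‖Φ(Z)‖ (Σ_{x∈Z} |f(x) − c_Z|)²`, `W = Σ_{x∈Λ'} f(x)q_x` — only the OSCILLATION of `f` over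
  the interaction ranges enters (the two subtractions of `c_Z` use `[Q_Z, Φ(Z)] = 0` and `[Q_Z, q_x] = 0`);
  `sum_norm_mul_sq_sum_le` turns it into `4‖q‖² |B_R| S_Ψ Σ_{x∈Λ'} b(x)²` for any pointwise modulus `|f(x) − f(y)| ≤ b(x)`
  (`‖x − y‖_∞ ≤ R`), by finite range and translation covariance;
* §4 `InfVolFermionState.IsTranslationInvariant.expect_eq_zero_of_conservedCharge` — THE CRITERION FOR A CONSERVED ON-SITE CHARGE:
  if `[Q_Λ, O] = κO`, `κ ≠ 0`, and for every `ε > 0` there are a finitely supported real `f ≡ 1` on `Λ` and a modulus `b` with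
  `Σ_x b(x)² ≤ ε` over the relevant box, then `ω(O) = 0` for every translation-invariant solution of the variational principle
  (and `IsVarEquilibrium.expect_eq_zero_of_conservedCharge`); the QUANTITATIVE forms `norm_sq_expect_le_of_double_commutator`,
  `norm_sq_expect_le_of_conservedCharge` (`|κ|²|ω(O)|² ≤ β‖O‖²·4‖q‖² Σ_Z ‖Φ Z‖(Σ_{x∈Z}|f x − c_Z|)²` for ANY cutoff) are the
  order-parameter bounds used for layered / quasi-two-dimensional models. In `d ≤ 2` such `f` exist (`Σ|∇f|² → 0` for the logarithmic cutoff):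
  that is the two-dimensional Mermin–Wagner theorem for equilibrium states, proved in the sequel file.

Everything is PROVED (standard axioms); three definitions (`chargeAt`, `chargeSum`, `weightedCharge`), no named fact.

## Mathlib / tree search

REUSED: `IsTranslationInvariant.bogoliubov_inequality_of_variationalPrinciple` (`VariationalPrincipleBogoliubovInequality`),
`commute_fermionEmbed_incl_of_disjoint`, `norm_fermionEmbed_le`, `fermionEmbed_fermionEmbed`, `fermionEmbed_congr`,
`fermionEmbed_parityAut`, `fermionEmbed_conjTranspose` (`InfVolFermionState`, `ErgodicStatesODLROProofs`),
`FermionInteraction.IsTranslationInvariant.sum_filter_mem_norm_le`, `HasFiniteRange.subset_thicken_singleton`, `thicken_singleton_eq`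
(`TranslationInvariantGroundStatesAreMeanEnergyMinimisers`), Mathlib `sq_sum_le_card_mul_sum_sq`, `noncomm_ring`.
`lean search 'MerminWagner|merminWagner'` (2026-08-28): finite-volume Gibbs states only (`Literature/Barriers/HubbardSuperconductivity/
HohenbergMerminWagnerPairing*`, `PositiveTemperatureNoPairLRO`).

## References

* A. Klein, L. J. Landau, D. S. Shucker, J. Stat. Phys. 26 (1981) 505–512 (Bogoliubov inequality for KMS states ⇒ absence of
  continuous symmetry breaking in `d ≤ 2`). [cite: KleinLandauShucker1981]
* F. J. Dyson, E. H. Lieb, B. Simon, J. Stat. Phys. 18 (1978) 335, §2 eq. (28). [cite: DLS1978, §2 eq. (28)]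
* H. Araki, H. Moriya, Rev. Math. Phys. 15 (2003) 93, Thm. 12.11. [cite: ArakiMoriya2003, Theorem 12.11]
* O. Bratteli, D. W. Robinson, *OAQSM 2* (1997), §5.2.2, §6.2.1 (graded locality, finite range). [cite: BratteliRobinsonII1997, §6.2.1]
-/

noncomputable section

open scoped ComplexOrder BigOperators Matrix.Norms.L2Operator
open Finset Literature.InformationTheory.Entropy

namespace Literature.MathematicalPhysics.QuantumLattice

open Matrix Literature.Probability.LatticeModels ThermodynamicLimit
open _root_.Filter
open scoped _root_.Topology

variable {d : ℕ}

/-! ### §0 Isotony bookkeeping -/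

/-- `Γ_{Λ₂⊆Λ₃} ∘ Γ_{Λ₁⊆Λ₂} = Γ_{Λ₁⊆Λ₃}` on elements (isotony is functorial). [cite: BratteliRobinsonII1997, §6.2.1] -/
theorem fermionEmbed_incl_fermionEmbed_incl {Λ₁ Λ₂ Λ₃ : Finset (Site d)} (h₁ : Λ₁ ⊆ Λ₂) (h₂ : Λ₂ ⊆ Λ₃) (A : FermionOp Λ₁) :
    fermionEmbed (PolySite.incl h₂) (fermionEmbed (PolySite.incl h₁) A) = fermionEmbed (PolySite.incl (h₁.trans h₂)) A := by
  rw [fermionEmbed_fermionEmbed]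
  exact congrFun (congrArg _ (fermionEmbed_congr fun y => Subtype.ext rfl)) A

/-- Isotony does not depend on the proof of the inclusion. [cite: BratteliRobinsonII1997, §6.2.1] -/
theorem fermionEmbed_incl_irrel {Λ₁ Λ₂ : Finset (Site d)} (h h' : Λ₁ ⊆ Λ₂) (A : FermionOp Λ₁) :
    fermionEmbed (PolySite.incl h) A = fermionEmbed (PolySite.incl h') A := rfl

/-! ### §1 The abstract criterion -/

section Criterion

variable (hd : 0 < d) {Ψ : FermionInteraction d} {R : ℝ} (hH : Ψ.IsHermitian) (hE : Ψ.IsEven)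
  (hT : Ψ.IsTranslationInvariant) (hR : Ψ.HasFiniteRange R) {β : ℝ} (hβ : 0 ≤ β) {ω : InfVolFermionState d}
  (hω : ω.IsTranslationInvariant)
  (hS : Tendsto (fun n : ℕ => vonNeumannEntropy (ω.rdm (halfOpenBox d n)) / ((n : ℝ) ^ d)) atTop
    (𝓝 (Ψ.freePressure β + β * ω.meanEnergy Ψ R)))
include hd hH hE hT hR hβ hω hS

/-- **QUANTITATIVE BOGOLIUBOV BOUND ON A CHARGED ONE-POINT FUNCTION**: if `C ∈ 𝔄_{Λ₁}` satisfies `C Õ − Õ C = κ Õ`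
(`Õ = Γ_{Λ⊆Λ₁}O`) then, for `Λ' ⊇ thicken Λ₁ R` and `C̃ = Γ_{Λ₁⊆Λ'}C`,
`|κ|² |ω(O)|² ≤ β ‖O‖² ‖C̃ᴴ(H_{Λ'}C̃ − C̃H_{Λ'}) − (H_{Λ'}C̃ − C̃H_{Λ'})C̃ᴴ‖` — Bogoliubov's inequality with `ω(ÕÕᴴ + ÕᴴÕ) ≤ 2‖O‖²`
and the double commutator bounded by its norm. [cite: KleinLandauShucker1981] [cite: DLS1978, §2 eq. (28)] -/
theorem InfVolFermionState.IsTranslationInvariant.norm_sq_expect_le_of_double_commutator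
    {Λ Λ₁ Λ' : Finset (Site d)} (h₁ : Λ ⊆ Λ₁) (hΛR : thicken Λ₁ R ⊆ Λ') (O : FermionOp Λ) {κ : ℂ} (C : FermionOp Λ₁)
    (hCO : C * fermionEmbed (PolySite.incl h₁) O - fermionEmbed (PolySite.incl h₁) O * C = κ • fermionEmbed (PolySite.incl h₁) O) :
    ‖κ‖ ^ 2 * ‖ω.expect Λ O‖ ^ 2 ≤ β * ‖O‖ ^ 2 *
      ‖(fermionEmbed (PolySite.incl ((subset_thicken Λ₁ R).trans hΛR)) C)ᴴ *
            (Ψ.localHamiltonian Λ' * fermionEmbed (PolySite.incl ((subset_thicken Λ₁ R).trans hΛR)) C -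
              fermionEmbed (PolySite.incl ((subset_thicken Λ₁ R).trans hΛR)) C * Ψ.localHamiltonian Λ') -
          (Ψ.localHamiltonian Λ' * fermionEmbed (PolySite.incl ((subset_thicken Λ₁ R).trans hΛR)) C -
              fermionEmbed (PolySite.incl ((subset_thicken Λ₁ R).trans hΛR)) C * Ψ.localHamiltonian Λ') *
            (fermionEmbed (PolySite.incl ((subset_thicken Λ₁ R).trans hΛR)) C)ᴴ‖ := by
  set Γ' := fermionEmbed (PolySite.incl ((subset_thicken Λ₁ R).trans hΛR)) with hΓ'
  set H := Ψ.localHamiltonian Λ' with hHdef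
  set O₁ := fermionEmbed (PolySite.incl h₁) O with hO₁
  set D := (Γ' C)ᴴ * (H * Γ' C - Γ' C * H) - (H * Γ' C - Γ' C * H) * (Γ' C)ᴴ with hD
  have hB := hω.bogoliubov_inequality_of_variationalPrinciple hd hH hE hT hR hβ hS hΛR O₁ C
  rw [← hΓ', ← hHdef] at hB
  have hcomm : Γ' C * Γ' O₁ - Γ' O₁ * Γ' C = κ • Γ' O₁ := by
    rw [← map_mul, ← map_mul, ← map_sub, hCO, map_smul]
  have hωO : ω.expect Λ' (Γ' O₁) = ω.expect Λ O := by
    rw [hΓ', hO₁, fermionEmbed_incl_fermionEmbed_incl]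
    exact ω.compatible _ O
  rw [hcomm, map_smul, smul_eq_mul, hωO, norm_mul, mul_pow] at hB
  have hP : (ω.expect Λ' (Γ' O₁ * (Γ' O₁)ᴴ + (Γ' O₁)ᴴ * Γ' O₁)).re ≤ 2 * ‖O‖ ^ 2 := by
    have hn : ‖Γ' O₁‖ ≤ ‖O‖ := (norm_fermionEmbed_le _ _).trans (norm_fermionEmbed_le _ _)
    have h1 : (ω.expect Λ' (Γ' O₁ * (Γ' O₁)ᴴ + (Γ' O₁)ᴴ * Γ' O₁)).re ≤ ‖Γ' O₁ * (Γ' O₁)ᴴ + (Γ' O₁)ᴴ * Γ' O₁‖ :=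
      (Complex.re_le_norm _).trans (ω.norm_expect_le Λ' _)
    have h2 : ‖Γ' O₁ * (Γ' O₁)ᴴ + (Γ' O₁)ᴴ * Γ' O₁‖ ≤ ‖Γ' O₁‖ * ‖Γ' O₁‖ + ‖Γ' O₁‖ * ‖Γ' O₁‖ := by
      refine (norm_add_le _ _).trans (add_le_add ?_ ?_)
      · exact (norm_mul_le _ _).trans (by rw [Matrix.l2_opNorm_conjTranspose])
      · exact (norm_mul_le _ _).trans (by rw [Matrix.l2_opNorm_conjTranspose])
    have h3 : ‖Γ' O₁‖ * ‖Γ' O₁‖ ≤ ‖O‖ * ‖O‖ := mul_le_mul hn hn (norm_nonneg _) (norm_nonneg _)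
    nlinarith
  have hP0 : 0 ≤ (ω.expect Λ' (Γ' O₁ * (Γ' O₁)ᴴ + (Γ' O₁)ᴴ * Γ' O₁)).re := by
    have ha : 0 ≤ (ω.expect Λ' (Γ' O₁ * (Γ' O₁)ᴴ)).re := by
      have h := ω.expect_nonneg Λ' (Γ' O₁)ᴴ
      rw [conjTranspose_conjTranspose] at h
      exact (Complex.nonneg_iff.1 h).1
    have hb : 0 ≤ (ω.expect Λ' ((Γ' O₁)ᴴ * Γ' O₁)).re := (Complex.nonneg_iff.1 (ω.expect_nonneg Λ' (Γ' O₁))).1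
    rw [map_add, Complex.add_re]; exact add_nonneg ha hb
  have hQ : (ω.expect Λ' D).re ≤ ‖D‖ := (Complex.re_le_norm _).trans (ω.norm_expect_le Λ' _)
  have hβP : 0 ≤ β / 2 * (ω.expect Λ' (Γ' O₁ * (Γ' O₁)ᴴ + (Γ' O₁)ᴴ * Γ' O₁)).re := mul_nonneg (by positivity) hP0
  calc ‖κ‖ ^ 2 * ‖ω.expect Λ O‖ ^ 2
      ≤ β / 2 * (ω.expect Λ' (Γ' O₁ * (Γ' O₁)ᴴ + (Γ' O₁)ᴴ * Γ' O₁)).re * (ω.expect Λ' D).re := hB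
    _ ≤ β / 2 * (ω.expect Λ' (Γ' O₁ * (Γ' O₁)ᴴ + (Γ' O₁)ᴴ * Γ' O₁)).re * ‖D‖ := mul_le_mul_of_nonneg_left hQ hβP
    _ ≤ β / 2 * (2 * ‖O‖ ^ 2) * ‖D‖ := by
        refine mul_le_mul_of_nonneg_right (mul_le_mul_of_nonneg_left hP (by positivity)) (norm_nonneg _)
    _ = β * ‖O‖ ^ 2 * ‖D‖ := by ring

/-- **THE MERMIN–WAGNER CRITERION FOR A SOLUTION OF THE VARIATIONAL PRINCIPLE** (Klein–Landau–Shucker's use of Bogoliubov's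
inequality): let `O ∈ 𝔄_Λ` and `κ ≠ 0`. Suppose that for every `ε > 0` there are regions `Λ ⊆ Λ₁`, `thicken Λ₁ R ⊆ Λ'` and
`C ∈ 𝔄_{Λ₁}` with `C Õ − Õ C = κ Õ` (`Õ = Γ_{Λ⊆Λ₁}O`) and `‖C̃ᴴ(H_{Λ'}C̃ − C̃H_{Λ'}) − (H_{Λ'}C̃ − C̃H_{Λ'})C̃ᴴ‖ ≤ ε` (`C̃ = Γ_{Λ₁⊆Λ'}C`).
Then `ω(O) = 0`: Bogoliubov gives `|κ|²|ω(O)|² ≤ ½β · ω(ÕÕᴴ + ÕᴴÕ) · ε ≤ β‖O‖²ε`.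
[cite: KleinLandauShucker1981] [cite: DLS1978, §2 eq. (28)] [cite: ArakiMoriya2003, Theorem 12.11] -/
theorem InfVolFermionState.IsTranslationInvariant.expect_eq_zero_of_small_double_commutators
    {Λ : Finset (Site d)} (O : FermionOp Λ) {κ : ℂ} (hκ : κ ≠ 0)
    (hgen : ∀ ε : ℝ, 0 < ε → ∃ (Λ₁ : Finset (Site d)) (h₁ : Λ ⊆ Λ₁) (Λ' : Finset (Site d)) (hΛR : thicken Λ₁ R ⊆ Λ')
      (C : FermionOp Λ₁),
        C * fermionEmbed (PolySite.incl h₁) O - fermionEmbed (PolySite.incl h₁) O * C = κ • fermionEmbed (PolySite.incl h₁) O ∧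
        ‖(fermionEmbed (PolySite.incl ((subset_thicken Λ₁ R).trans hΛR)) C)ᴴ *
              (Ψ.localHamiltonian Λ' * fermionEmbed (PolySite.incl ((subset_thicken Λ₁ R).trans hΛR)) C -
                fermionEmbed (PolySite.incl ((subset_thicken Λ₁ R).trans hΛR)) C * Ψ.localHamiltonian Λ') -
            (Ψ.localHamiltonian Λ' * fermionEmbed (PolySite.incl ((subset_thicken Λ₁ R).trans hΛR)) C -
                fermionEmbed (PolySite.incl ((subset_thicken Λ₁ R).trans hΛR)) C * Ψ.localHamiltonian Λ') *
              (fermionEmbed (PolySite.incl ((subset_thicken Λ₁ R).trans hΛR)) C)ᴴ‖ ≤ ε) :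
    ω.expect Λ O = 0 := by
  -- `|κ|²‖ω(O)‖² ≤ β‖O‖²ε` for every `ε > 0`
  have key : ∀ ε : ℝ, 0 < ε → ‖κ‖ ^ 2 * ‖ω.expect Λ O‖ ^ 2 ≤ β * ‖O‖ ^ 2 * ε := by
    intro ε hε
    obtain ⟨Λ₁, h₁, Λ', hΛR, C, hCO, hD⟩ := hgen ε hε
    exact (hω.norm_sq_expect_le_of_double_commutator hd hH hE hT hR hβ hS h₁ hΛR O C hCO).trans
      (mul_le_mul_of_nonneg_left hD (by positivity))
  -- hence `‖κ‖²‖ω(O)‖² ≤ 0`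
  have h0 : ‖κ‖ ^ 2 * ‖ω.expect Λ O‖ ^ 2 ≤ 0 := by
    by_contra h
    rw [not_le] at h
    set X := ‖κ‖ ^ 2 * ‖ω.expect Λ O‖ ^ 2 with hX
    set K := β * ‖O‖ ^ 2 with hK
    have hK0 : 0 ≤ K := by positivity
    have hK1 : K + 1 ≠ 0 := by positivity
    have h1 := key (X / (2 * (K + 1))) (by positivity)
    have h2 : K * (X / (2 * (K + 1))) ≤ (K + 1) * (X / (2 * (K + 1))) :=
      mul_le_mul_of_nonneg_right (by linarith) (by positivity)
    have h3 : (K + 1) * (X / (2 * (K + 1))) = X / 2 := by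
      field_simp
    linarith
  have hκ2 : 0 < ‖κ‖ ^ 2 := by positivity
  have h1 : ‖ω.expect Λ O‖ ^ 2 ≤ 0 := by
    by_contra h; rw [not_le] at h; nlinarith
  have h2 : ‖ω.expect Λ O‖ = 0 := by nlinarith [norm_nonneg (ω.expect Λ O), sq_nonneg ‖ω.expect Λ O‖]
  exact norm_eq_zero.1 h2

end Criterion

/-! ### §2 On-site charges: translates of an observable at the origin, their sums and weighted sums -/

section Charges

/-- `{0} + x ⊆ Λ` for `x ∈ Λ`. [cite: BratteliRobinsonII1997, §6.2.1] -/
theorem shiftSet_zero_singleton_subset {Λ : Finset (Site d)} {x : Site d} (hx : x ∈ Λ) :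
    shiftSet x ({0} : Finset (Site d)) ⊆ Λ := by
  intro y hy
  rw [mem_shiftSet, Finset.mem_singleton, sub_eq_zero] at hy
  rw [hy]; exact hx

/-- **The on-site charge at `x`**: the translate `q_x = Γ(ι ∘ τ_x) q ∈ 𝔄_Λ` of an observable `q ∈ 𝔄_{{0}}` at the origin
(e.g. `q = n_{0↑} + n_{0↓}` for the particle number, `q = S^z_0` for spin rotations about `z`), and `0` if `x ∉ Λ`.
[cite: KleinLandauShucker1981] [cite: BratteliRobinsonII1997, §6.2.1] -/
def chargeAt (q : FermionOp ({0} : Finset (Site d))) (Λ : Finset (Site d)) (x : Site d) : FermionOp Λ :=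
  if hx : x ∈ Λ then fermionEmbed ((PolySite.shiftEmb x {0}).trans (PolySite.incl (shiftSet_zero_singleton_subset hx))) q else 0

/-- **The total charge of a region**, `Q_Λ = Σ_{x∈Λ} q_x`. [cite: KleinLandauShucker1981] -/
def chargeSum (q : FermionOp ({0} : Finset (Site d))) (Λ : Finset (Site d)) : FermionOp Λ :=
  ∑ x ∈ Λ, chargeAt q Λ x

/-- **The smeared generator** `W_f = Σ_{x∈Λ} f(x) q_x` (real weights). [cite: KleinLandauShucker1981] -/
def weightedCharge (q : FermionOp ({0} : Finset (Site d))) (f : Site d → ℝ) (Λ : Finset (Site d)) : FermionOp Λ :=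
  ∑ x ∈ Λ, ((f x : ℝ) : ℂ) • chargeAt q Λ x

variable (q : FermionOp ({0} : Finset (Site d)))

/-- `q_x` for `x ∈ Λ` is the translate of `q`. [cite: BratteliRobinsonII1997, §6.2.1] -/
theorem chargeAt_of_mem {Λ : Finset (Site d)} {x : Site d} (hx : x ∈ Λ) :
    chargeAt q Λ x = fermionEmbed ((PolySite.shiftEmb x {0}).trans (PolySite.incl (shiftSet_zero_singleton_subset hx))) q :=
  dif_pos hx

/-- `q_x = 0` in `𝔄_Λ` for `x ∉ Λ` (convention). [cite: BratteliRobinsonII1997, §6.2.1] -/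
theorem chargeAt_of_not_mem {Λ : Finset (Site d)} {x : Site d} (hx : x ∉ Λ) : chargeAt q Λ x = 0 := dif_neg hx

/-- Isotony: `Γ_{Λ⊆Λ'} q_x = q_x`. [cite: BratteliRobinsonII1997, §6.2.1] -/
theorem fermionEmbed_incl_chargeAt {Λ Λ' : Finset (Site d)} (h : Λ ⊆ Λ') {x : Site d} (hx : x ∈ Λ) :
    fermionEmbed (PolySite.incl h) (chargeAt q Λ x) = chargeAt q Λ' x := by
  rw [chargeAt_of_mem q hx, chargeAt_of_mem q (h hx), fermionEmbed_fermionEmbed]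
  exact congrFun (congrArg _ (fermionEmbed_congr fun y => Subtype.ext rfl)) q

/-- `q_x ∈ 𝔄_Λ` is the isotony image of `q_x ∈ 𝔄_{{x}}`. [cite: BratteliRobinsonII1997, §6.2.1] -/
theorem chargeAt_eq_fermionEmbed_singleton {Λ : Finset (Site d)} {x : Site d} (hx : x ∈ Λ) :
    chargeAt q Λ x = fermionEmbed (PolySite.incl (Finset.singleton_subset_iff.2 hx)) (chargeAt q {x} x) := by
  rw [fermionEmbed_incl_chargeAt q _ (Finset.mem_singleton_self x)]

/-- `‖q_x‖ ≤ ‖q‖` (`Γ` is norm-contractive). [cite: BratteliRobinsonII1997, §5.2.2] -/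
theorem norm_chargeAt_le (Λ : Finset (Site d)) (x : Site d) : ‖chargeAt q Λ x‖ ≤ ‖q‖ := by
  by_cases hx : x ∈ Λ
  · rw [chargeAt_of_mem q hx]; exact norm_fermionEmbed_le _ _
  · rw [chargeAt_of_not_mem q hx, norm_zero]; exact norm_nonneg _

variable {q}

/-- Translates of an even charge are even (`Θ` commutes with translations). [cite: ArakiMoriya2003, §4.1 Def. 4.3 (τ_k Θ = Θ τ_k)] -/
theorem parityAut_chargeAt (hqe : parityAut q = q) (Λ : Finset (Site d)) (x : Site d) :
    parityAut (chargeAt q Λ x) = chargeAt q Λ x := by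
  by_cases hx : x ∈ Λ
  · rw [chargeAt_of_mem q hx, ← fermionEmbed_parityAut, hqe]
  · rw [chargeAt_of_not_mem q hx, map_zero]

/-- Translates of a Hermitian charge are Hermitian (`Γ` is a `*`-map). [cite: BratteliRobinsonII1997, §5.2.2] -/
theorem conjTranspose_chargeAt (hq : q.IsHermitian) (Λ : Finset (Site d)) (x : Site d) :
    (chargeAt q Λ x)ᴴ = chargeAt q Λ x := by
  by_cases hx : x ∈ Λ
  · rw [chargeAt_of_mem q hx, ← fermionEmbed_conjTranspose, hq.eq]
  · rw [chargeAt_of_not_mem q hx, conjTranspose_zero]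

/-- The smeared generator of a Hermitian charge with real weights is Hermitian. [cite: KleinLandauShucker1981] -/
theorem conjTranspose_weightedCharge (hq : q.IsHermitian) (f : Site d → ℝ) (Λ : Finset (Site d)) :
    (weightedCharge q f Λ)ᴴ = weightedCharge q f Λ := by
  unfold weightedCharge
  rw [Matrix.conjTranspose_sum]
  refine Finset.sum_congr rfl fun x _ => ?_
  rw [conjTranspose_smul, conjTranspose_chargeAt hq]
  simp only [Complex.star_def, Complex.conj_ofReal]

/-- **Graded locality**: an even charge at `y ∉ Z` commutes with every observable of `Z`. [cite: BratteliRobinsonII1997, §5.2.2] -/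
theorem commute_chargeAt_fermionEmbed_incl (hqe : parityAut q = q) {Z Λ' : Finset (Site d)} (hZ : Z ⊆ Λ') {y : Site d}
    (hy : y ∉ Z) (B : FermionOp Z) : Commute (chargeAt q Λ' y) (fermionEmbed (PolySite.incl hZ) B) := by
  by_cases hyΛ : y ∈ Λ'
  · rw [chargeAt_eq_fermionEmbed_singleton q hyΛ]
    exact commute_fermionEmbed_incl_of_disjoint (parityAut_chargeAt hqe _ _) _ hZ (Finset.disjoint_singleton_left.2 hy) B
  · rw [chargeAt_of_not_mem q hyΛ]; exact Commute.zero_left _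

/-- Charges at different (or equal) sites commute. [cite: BratteliRobinsonII1997, §5.2.2] -/
theorem commute_chargeAt_chargeAt (hqe : parityAut q = q) (Λ : Finset (Site d)) (x y : Site d) :
    Commute (chargeAt q Λ x) (chargeAt q Λ y) := by
  by_cases hxy : x = y
  · rw [hxy]
  · by_cases hy : y ∈ Λ
    · rw [chargeAt_eq_fermionEmbed_singleton q hy]
      exact commute_chargeAt_fermionEmbed_incl hqe _ (by rwa [Finset.mem_singleton]) _
    · rw [chargeAt_of_not_mem q hy]; exact Commute.zero_right _

/-- The total charge commutes with each charge. [cite: BratteliRobinsonII1997, §5.2.2] -/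
theorem commute_chargeSum_chargeAt (hqe : parityAut q = q) (Λ : Finset (Site d)) (x : Site d) :
    Commute (chargeSum q Λ) (chargeAt q Λ x) :=
  Commute.sum_left _ _ _ fun y _ => commute_chargeAt_chargeAt hqe Λ y x

/-- **The smeared generator acts on a local observable through the total charge of its support**: for `Λ ⊆ Λ₁`, `f ≡ 1` on
`Λ` and `O ∈ 𝔄_Λ`, `W_f Õ − Õ W_f = Γ(Q_Λ O − O Q_Λ)` (the charges outside `Λ` are even and commute with `Õ`).
[cite: KleinLandauShucker1981] -/
theorem weightedCharge_commutator_fermionEmbed (hqe : parityAut q = q) {Λ Λ₁ : Finset (Site d)} (h₁ : Λ ⊆ Λ₁)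
    {f : Site d → ℝ} (hf1 : ∀ x ∈ Λ, f x = 1) (O : FermionOp Λ) :
    weightedCharge q f Λ₁ * fermionEmbed (PolySite.incl h₁) O - fermionEmbed (PolySite.incl h₁) O * weightedCharge q f Λ₁ =
      fermionEmbed (PolySite.incl h₁) (chargeSum q Λ * O - O * chargeSum q Λ) := by
  unfold weightedCharge chargeSum
  rw [Finset.sum_mul, Finset.mul_sum, ← Finset.sum_sub_distrib, Finset.sum_mul, Finset.mul_sum, ← Finset.sum_sub_distrib, map_sum,
    ← Finset.sum_sdiff h₁]
  have hout : ∑ x ∈ Λ₁ \ Λ, (((f x : ℝ) : ℂ) • chargeAt q Λ₁ x * fermionEmbed (PolySite.incl h₁) O -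
      fermionEmbed (PolySite.incl h₁) O * (((f x : ℝ) : ℂ) • chargeAt q Λ₁ x)) = 0 := by
    refine Finset.sum_eq_zero fun x hx => ?_
    rw [Finset.mem_sdiff] at hx
    rw [Matrix.smul_mul, Matrix.mul_smul, ← smul_sub, (commute_chargeAt_fermionEmbed_incl hqe h₁ hx.2 O).eq, sub_self, smul_zero]
  rw [hout, zero_add]
  refine Finset.sum_congr rfl fun x hx => ?_
  rw [hf1 x hx, Complex.ofReal_one, one_smul, map_sub, map_mul, map_mul, fermionEmbed_incl_chargeAt q h₁ hx]

/-- The smeared generator only sees the weights on its region: if `f = 0` on `Λ' ∖ Λ₁` then `Γ_{Λ₁⊆Λ'} W_f^{Λ₁} = W_f^{Λ'}`. [cite: KleinLandauShucker1981] -/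
theorem fermionEmbed_incl_weightedCharge {Λ₁ Λ' : Finset (Site d)} (h : Λ₁ ⊆ Λ') {f : Site d → ℝ}
    (hf0 : ∀ x ∈ Λ', x ∉ Λ₁ → f x = 0) :
    fermionEmbed (PolySite.incl h) (weightedCharge q f Λ₁) = weightedCharge q f Λ' := by
  unfold weightedCharge
  rw [map_sum]
  symm
  refine (Finset.sum_subset h fun x hx hx₁ => ?_).symm.trans (Finset.sum_congr rfl fun x hx => ?_)
  · rw [hf0 x hx hx₁, Complex.ofReal_zero, zero_smul]
  · rw [map_smul, fermionEmbed_incl_chargeAt q h hx]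

/-- `W_f Γ_{Z⊆Λ'}B − Γ_{Z⊆Λ'}B W_f = Σ_{y∈Z} f(y) Γ_{Z⊆Λ'}(q_y B − B q_y)` for `B ∈ 𝔄_Z`: only the charges inside `Z` act (graded locality). [cite: BratteliRobinsonII1997, §5.2.2] -/
theorem weightedCharge_commutator_fermionEmbed_eq_sum (hqe : parityAut q = q) {Z Λ' : Finset (Site d)} (hZ : Z ⊆ Λ')
    (f : Site d → ℝ) (B : FermionOp Z) :
    weightedCharge q f Λ' * fermionEmbed (PolySite.incl hZ) B - fermionEmbed (PolySite.incl hZ) B * weightedCharge q f Λ' =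
      ∑ y ∈ Z, ((f y : ℝ) : ℂ) • fermionEmbed (PolySite.incl hZ) (chargeAt q Z y * B - B * chargeAt q Z y) := by
  unfold weightedCharge
  rw [Finset.sum_mul, Finset.mul_sum, ← Finset.sum_sub_distrib]
  symm
  refine (Finset.sum_subset hZ fun y _ hyZ => ?_).trans (Finset.sum_congr rfl fun y _ => ?_)
  · rw [chargeAt_of_not_mem q hyZ, zero_mul, mul_zero, sub_self, map_zero, smul_zero]
  · by_cases hyZ : y ∈ Z
    · rw [Matrix.smul_mul, Matrix.mul_smul, ← smul_sub, map_sub, map_mul, map_mul, fermionEmbed_incl_chargeAt q hZ hyZ]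
    · rw [chargeAt_of_not_mem q hyZ, zero_mul, mul_zero, sub_self, map_zero, smul_zero, Matrix.smul_mul, Matrix.mul_smul,
        ← smul_sub, (commute_chargeAt_fermionEmbed_incl hqe hZ hyZ B).eq, sub_self, smul_zero]

end Charges

/-! ### §3 The double-commutator bound for a charge-conserving interaction -/

section DoubleCommutator

variable {q : FermionOp ({0} : Finset (Site d))} {Ψ : FermionInteraction d}

/-- A double sum whose kernel has vanishing row and column sums is unchanged by subtracting constants from the weights. [folklore] -/
private theorem sum_sum_sub_smul_eq {ι M : Type*} [AddCommGroup M] [Module ℂ M] (Z : Finset ι) (f : ι → ℝ) (c : ℝ) (T : ι → ι → M)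
    (h1 : ∀ x ∈ Z, ∑ y ∈ Z, T x y = 0) (h2 : ∀ y ∈ Z, ∑ x ∈ Z, T x y = 0) :
    ∑ x ∈ Z, ∑ y ∈ Z, (((f x - c : ℝ) : ℂ) * ((f y - c : ℝ) : ℂ)) • T x y = ∑ x ∈ Z, ∑ y ∈ Z, (((f x : ℝ) : ℂ) * ((f y : ℝ) : ℂ)) • T x y := by
  have e : ∀ x y, (((f x - c : ℝ) : ℂ) * ((f y - c : ℝ) : ℂ)) • T x y =
      (((f x : ℝ) : ℂ) * ((f y : ℝ) : ℂ)) • T x y + ((((c ^ 2 - c * f x : ℝ)) : ℂ) • T x y + (((-(c * f y) : ℝ)) : ℂ) • T x y) := by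
    intro x y
    rw [← add_smul, ← add_smul]
    congr 1
    push_cast
    ring
  simp_rw [e, Finset.sum_add_distrib]
  have ha : ∑ x ∈ Z, ∑ y ∈ Z, (((c ^ 2 - c * f x : ℝ)) : ℂ) • T x y = 0 := by
    refine Finset.sum_eq_zero fun x hx => ?_
    rw [← Finset.smul_sum, h1 x hx, smul_zero]
  have hb : ∑ x ∈ Z, ∑ y ∈ Z, (((-(c * f y) : ℝ)) : ℂ) • T x y = 0 := by
    rw [Finset.sum_comm]
    refine Finset.sum_eq_zero fun y hy => ?_
    rw [← Finset.smul_sum, h2 y hy, smul_zero]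
  rw [ha, hb, add_zero, add_zero]

/-- **Conservation kills the row and column sums.** If `Q_Z Φ = Φ Q_Z` and the charges commute, then with `B_x = q_xΦ − Φq_x`:
`Σ_x B_x = 0`, `Σ_y (q_y B_x − B_x q_y) = Q_Z B_x − B_x Q_Z = 0`, `Σ_x (q_y B_x − B_x q_y) = 0`. [cite: KleinLandauShucker1981] -/
private theorem sum_doubleComm_eq_zero (hqe : parityAut q = q) {Z : Finset (Site d)} {Φ : FermionOp Z}
    (hcons : Commute (chargeSum q Z) Φ) :
    (∀ x ∈ Z, ∑ y ∈ Z, (chargeAt q Z y * (chargeAt q Z x * Φ - Φ * chargeAt q Z x) -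
        (chargeAt q Z x * Φ - Φ * chargeAt q Z x) * chargeAt q Z y) = 0) ∧
      (∀ y ∈ Z, ∑ x ∈ Z, (chargeAt q Z y * (chargeAt q Z x * Φ - Φ * chargeAt q Z x) -
        (chargeAt q Z x * Φ - Φ * chargeAt q Z x) * chargeAt q Z y) = 0) := by
  constructor
  · intro x _
    set Q := chargeSum q Z with hQ
    set a := chargeAt q Z x with ha
    have hQa : Q * a = a * Q := (commute_chargeSum_chargeAt hqe Z x).eq
    have hQΦ : Q * Φ = Φ * Q := hcons.eq
    rw [Finset.sum_sub_distrib, ← Finset.sum_mul, ← Finset.mul_sum]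
    show Q * (a * Φ - Φ * a) - (a * Φ - Φ * a) * Q = 0
    calc Q * (a * Φ - Φ * a) - (a * Φ - Φ * a) * Q = (Q * a) * Φ - (Q * Φ) * a - (a * Φ - Φ * a) * Q := by noncomm_ring
      _ = (a * Q) * Φ - (Φ * Q) * a - (a * Φ - Φ * a) * Q := by rw [hQa, hQΦ]
      _ = a * (Q * Φ) - Φ * (Q * a) - (a * Φ - Φ * a) * Q := by noncomm_ring
      _ = a * (Φ * Q) - Φ * (a * Q) - (a * Φ - Φ * a) * Q := by rw [hQΦ, hQa]
      _ = 0 := by noncomm_ring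
  · intro y _
    set Q := chargeSum q Z with hQ
    set b := chargeAt q Z y with hb
    have hQΦ : Q * Φ = Φ * Q := hcons.eq
    have hsum : ∑ x ∈ Z, (chargeAt q Z x * Φ - Φ * chargeAt q Z x) = Q * Φ - Φ * Q := by
      rw [Finset.sum_sub_distrib, ← Finset.sum_mul, ← Finset.mul_sum]
      rfl
    rw [Finset.sum_sub_distrib, ← Finset.mul_sum, ← Finset.sum_mul, hsum, hQΦ, sub_self, mul_zero, zero_mul, sub_self]

/-- **THE DOUBLE COMMUTATOR OF THE SMEARED GENERATOR WITH ONE CONSERVING TERM**: for `Φ ∈ 𝔄_Z` with `Q_Z Φ = Φ Q_Z`, `q` even,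
real `f` and ANY real `c`,
`‖W(WT − TW) − (WT − TW)W‖ ≤ 4‖q‖²‖Φ‖ (Σ_{x∈Z} |f(x) − c|)²`, `T = Γ_{Z⊆Λ'}Φ`, `W = Σ_{x∈Λ'} f(x)q_x`.
[cite: KleinLandauShucker1981] -/
theorem norm_doubleCommutator_weightedCharge_term_le (hqe : parityAut q = q) {Z Λ' : Finset (Site d)} (hZ : Z ⊆ Λ')
    {Φ : FermionOp Z} (hcons : Commute (chargeSum q Z) Φ) (f : Site d → ℝ) (c : ℝ) :
    ‖weightedCharge q f Λ' * (weightedCharge q f Λ' * fermionEmbed (PolySite.incl hZ) Φ - fermionEmbed (PolySite.incl hZ) Φ *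
        weightedCharge q f Λ') - (weightedCharge q f Λ' * fermionEmbed (PolySite.incl hZ) Φ - fermionEmbed (PolySite.incl hZ) Φ *
        weightedCharge q f Λ') * weightedCharge q f Λ'‖ ≤ 4 * ‖q‖ ^ 2 * ‖Φ‖ * (∑ x ∈ Z, |f x - c|) ^ 2 := by
  set W := weightedCharge q f Λ' with hW
  set Γ := fermionEmbed (PolySite.incl hZ) with hΓ
  set B : Site d → FermionOp Z := fun x => chargeAt q Z x * Φ - Φ * chargeAt q Z x with hB
  set T : Site d → Site d → FermionOp Z := fun x y => chargeAt q Z y * B x - B x * chargeAt q Z y with hT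
  -- the double commutator as a double sum
  have h1 : W * Γ Φ - Γ Φ * W = ∑ x ∈ Z, ((f x : ℝ) : ℂ) • Γ (B x) :=
    weightedCharge_commutator_fermionEmbed_eq_sum hqe hZ f Φ
  have h2 : W * (W * Γ Φ - Γ Φ * W) - (W * Γ Φ - Γ Φ * W) * W =
      ∑ x ∈ Z, ∑ y ∈ Z, (((f x : ℝ) : ℂ) * ((f y : ℝ) : ℂ)) • Γ (T x y) := by
    rw [h1, Finset.mul_sum, Finset.sum_mul, ← Finset.sum_sub_distrib]
    refine Finset.sum_congr rfl fun x _ => ?_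
    rw [Matrix.mul_smul, Matrix.smul_mul, ← smul_sub, weightedCharge_commutator_fermionEmbed_eq_sum hqe hZ f (B x), Finset.smul_sum]
    refine Finset.sum_congr rfl fun y _ => ?_
    rw [smul_smul]
  obtain ⟨hrow, hcol⟩ := sum_doubleComm_eq_zero hqe hcons
  have h3 : ∑ x ∈ Z, ∑ y ∈ Z, (((f x : ℝ) : ℂ) * ((f y : ℝ) : ℂ)) • Γ (T x y) =
      ∑ x ∈ Z, ∑ y ∈ Z, (((f x - c : ℝ) : ℂ) * ((f y - c : ℝ) : ℂ)) • Γ (T x y) := by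
    refine (sum_sum_sub_smul_eq Z f c (fun x y => Γ (T x y)) (fun x hx => ?_) (fun y hy => ?_)).symm
    · rw [← map_sum, hrow x hx, map_zero]
    · rw [← map_sum, hcol y hy, map_zero]
  rw [h2, h3]
  -- norms
  have hTn : ∀ x y, ‖Γ (T x y)‖ ≤ 4 * ‖q‖ ^ 2 * ‖Φ‖ := by
    intro x y
    refine (norm_fermionEmbed_le _ _).trans ?_
    have hBx : ‖B x‖ ≤ 2 * ‖q‖ * ‖Φ‖ :=
      (norm_commutator_le _ _).trans (by nlinarith [norm_chargeAt_le q Z x, norm_nonneg Φ, norm_nonneg q])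
    calc ‖T x y‖ ≤ 2 * ‖chargeAt q Z y‖ * ‖B x‖ := norm_commutator_le _ _
      _ ≤ 2 * ‖q‖ * (2 * ‖q‖ * ‖Φ‖) := by
          nlinarith [norm_chargeAt_le q Z y, norm_nonneg (B x), norm_nonneg q, norm_nonneg (chargeAt q Z y), norm_nonneg Φ]
      _ = 4 * ‖q‖ ^ 2 * ‖Φ‖ := by ring
  calc ‖∑ x ∈ Z, ∑ y ∈ Z, (((f x - c : ℝ) : ℂ) * ((f y - c : ℝ) : ℂ)) • Γ (T x y)‖
      ≤ ∑ x ∈ Z, ‖∑ y ∈ Z, (((f x - c : ℝ) : ℂ) * ((f y - c : ℝ) : ℂ)) • Γ (T x y)‖ := norm_sum_le _ _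
    _ ≤ ∑ x ∈ Z, ∑ y ∈ Z, |f x - c| * |f y - c| * (4 * ‖q‖ ^ 2 * ‖Φ‖) := by
        refine Finset.sum_le_sum fun x _ => (norm_sum_le _ _).trans (Finset.sum_le_sum fun y _ => ?_)
        rw [norm_smul, norm_mul, Complex.norm_real, Complex.norm_real, Real.norm_eq_abs, Real.norm_eq_abs]
        exact mul_le_mul_of_nonneg_left (hTn x y) (mul_nonneg (abs_nonneg _) (abs_nonneg _))
    _ = 4 * ‖q‖ ^ 2 * ‖Φ‖ * (∑ x ∈ Z, |f x - c|) ^ 2 := by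
        rw [pow_two (∑ x ∈ Z, |f x - c|), Finset.sum_mul_sum, Finset.mul_sum]
        refine Finset.sum_congr rfl fun x _ => ?_
        rw [Finset.mul_sum]
        refine Finset.sum_congr rfl fun y _ => ?_
        ring

/-- **THE DOUBLE-COMMUTATOR BOUND** (the quantity in Bogoliubov's inequality): for an even charge `q`, an interaction `Ψ` each of
whose terms conserves the charge of its region (`Q_Z Φ(Z) = Φ(Z) Q_Z`), a real weight `f` and ANY constants `c_Z`,
`‖W(H_{Λ'}W − WH_{Λ'}) − (H_{Λ'}W − WH_{Λ'})W‖ ≤ 4‖q‖² Σ_{Z⊆Λ'} ‖Φ(Z)‖ (Σ_{x∈Z} |f(x) − c_Z|)²`, `W = Σ_{x∈Λ'} f(x) q_x`.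
[cite: KleinLandauShucker1981] -/
theorem norm_doubleCommutator_weightedCharge_localHamiltonian_le (hqe : parityAut q = q)
    (hcons : ∀ Z : Finset (Site d), Commute (chargeSum q Z) (Ψ.Φ Z)) (Λ' : Finset (Site d)) (f : Site d → ℝ)
    (c : Finset (Site d) → ℝ) :
    ‖weightedCharge q f Λ' * (Ψ.localHamiltonian Λ' * weightedCharge q f Λ' - weightedCharge q f Λ' * Ψ.localHamiltonian Λ') -
        (Ψ.localHamiltonian Λ' * weightedCharge q f Λ' - weightedCharge q f Λ' * Ψ.localHamiltonian Λ') * weightedCharge q f Λ'‖ ≤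
      4 * ‖q‖ ^ 2 * ∑ Z ∈ Λ'.powerset, ‖Ψ.Φ Z‖ * (∑ x ∈ Z, |f x - c Z|) ^ 2 := by
  set W := weightedCharge q f Λ' with hW
  unfold FermionInteraction.localHamiltonian
  rw [Finset.sum_mul, Finset.mul_sum, ← Finset.sum_sub_distrib, Finset.mul_sum, Finset.sum_mul, ← Finset.sum_sub_distrib]
  refine (norm_sum_le _ _).trans ?_
  rw [Finset.mul_sum, ← Finset.sum_attach Λ'.powerset]
  refine Finset.sum_le_sum fun Z _ => ?_
  have h := norm_doubleCommutator_weightedCharge_term_le hqe (Finset.mem_powerset.1 Z.2) (hcons Z.1) f (c Z.1) (Λ' := Λ')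
  rw [← hW] at h
  -- `W(TW − WT) − (TW − WT)W = −(W(WT − TW) − (WT − TW)W)`
  have e : W * (fermionEmbed (PolySite.incl (Finset.mem_powerset.1 Z.2)) (Ψ.Φ Z.1) * W -
      W * fermionEmbed (PolySite.incl (Finset.mem_powerset.1 Z.2)) (Ψ.Φ Z.1)) -
      (fermionEmbed (PolySite.incl (Finset.mem_powerset.1 Z.2)) (Ψ.Φ Z.1) * W -
        W * fermionEmbed (PolySite.incl (Finset.mem_powerset.1 Z.2)) (Ψ.Φ Z.1)) * W =
      -(W * (W * fermionEmbed (PolySite.incl (Finset.mem_powerset.1 Z.2)) (Ψ.Φ Z.1) -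
        fermionEmbed (PolySite.incl (Finset.mem_powerset.1 Z.2)) (Ψ.Φ Z.1) * W) -
        (W * fermionEmbed (PolySite.incl (Finset.mem_powerset.1 Z.2)) (Ψ.Φ Z.1) -
          fermionEmbed (PolySite.incl (Finset.mem_powerset.1 Z.2)) (Ψ.Φ Z.1) * W) * W) := by
    noncomm_ring
  rw [e, norm_neg]
  calc _ ≤ 4 * ‖q‖ ^ 2 * ‖Ψ.Φ Z.1‖ * (∑ x ∈ Z.1, |f x - c Z.1|) ^ 2 := h
    _ = 4 * ‖q‖ ^ 2 * (‖Ψ.Φ Z.1‖ * (∑ x ∈ Z.1, |f x - c Z.1|) ^ 2) := by ring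

/-- **From oscillations to a pointwise modulus** (finite range and translation covariance): if `Ψ` has finite range `R`, is
translation covariant, and `|f(x) − f(y)| ≤ b(x)` whenever `y − x ∈ box ⌊R⌋` (`‖y − x‖_∞ ≤ R`), then
`Σ_{Z⊆Λ'} ‖Φ(Z)‖ (Σ_{x∈Z} |f(x) − c_Z|)² ≤ |box ⌊R⌋| · S_Ψ · Σ_{x∈Λ'} b(x)²` for the choice `c_Z = f(z_Z)`, `z_Z ∈ Z`
(`S_Ψ = Σ_{Z∋0} ‖Φ(Z)‖`). [cite: BratteliRobinsonII1997, §6.2.1] -/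
theorem FermionInteraction.sum_norm_mul_sq_sum_le {R : ℝ} (hT : Ψ.IsTranslationInvariant) (hR : Ψ.HasFiniteRange R)
    (Λ' : Finset (Site d)) {f b : Site d → ℝ}
    (hb : ∀ x y : Site d, y - x ∈ box d ⌊R⌋₊ → |f x - f y| ≤ b x) :
    ∃ c : Finset (Site d) → ℝ,
      ∑ Z ∈ Λ'.powerset, ‖Ψ.Φ Z‖ * (∑ x ∈ Z, |f x - c Z|) ^ 2 ≤
        ((box d ⌊R⌋₊).card : ℝ) * (∑ X ∈ (thicken ({0} : Finset (Site d)) R).powerset with (0 : Site d) ∈ X, ‖Ψ.Φ X‖) *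
          ∑ x ∈ Λ', b x ^ 2 := by
  classical
  -- anchors
  refine ⟨fun Z => if h : Z.Nonempty then f h.choose else 0, ?_⟩
  set N : ℝ := ((box d ⌊R⌋₊).card : ℝ) with hN
  set S : ℝ := ∑ X ∈ (thicken ({0} : Finset (Site d)) R).powerset with (0 : Site d) ∈ X, ‖Ψ.Φ X‖ with hS
  -- each term: `‖Φ Z‖ (Σ |f x − f z|)² ≤ ‖Φ Z‖ · N · Σ_{x∈Z} b(x)²`
  have hterm : ∀ Z ∈ Λ'.powerset, ‖Ψ.Φ Z‖ * (∑ x ∈ Z, |f x - (if h : Z.Nonempty then f h.choose else 0)|) ^ 2 ≤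
      ‖Ψ.Φ Z‖ * (N * ∑ x ∈ Z, b x ^ 2) := by
    intro Z _
    by_cases hΦ : Ψ.Φ Z = 0
    · rw [hΦ, norm_zero, zero_mul, zero_mul]
    refine mul_le_mul_of_nonneg_left ?_ (norm_nonneg _)
    by_cases hZ : Z.Nonempty
    · rw [dif_pos hZ]
      set z := hZ.choose with hz
      have hzZ : z ∈ Z := hZ.choose_spec
      -- `Z ⊆ thicken {z} R`, so `|Z| ≤ N` and `x − z ∈ box` for `x ∈ Z`
      have hZR : Z ⊆ thicken ({z} : Finset (Site d)) R := hR.subset_thicken_singleton hΦ hzZ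
      have hcard : (Z.card : ℝ) ≤ N := by
        rw [hN]; exact_mod_cast (Finset.card_le_card hZR).trans (by rw [thicken_singleton_eq]; exact Finset.card_image_le)
      have h1 : ∑ x ∈ Z, |f x - f z| ≤ ∑ x ∈ Z, b x :=
        Finset.sum_le_sum fun x hx => hb x z (by
          have := mem_thicken_singleton_iff.1 (hZR hx)
          -- `x - z ∈ box` ⇒ `z - x ∈ box` (the box is symmetric)
          rw [mem_box_iff_supNorm_le] at this ⊢
          rwa [← neg_sub, Site.supNorm_neg'])
      have h0 : 0 ≤ ∑ x ∈ Z, |f x - f z| := Finset.sum_nonneg fun x _ => abs_nonneg _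
      calc (∑ x ∈ Z, |f x - f z|) ^ 2 ≤ (∑ x ∈ Z, b x) ^ 2 := pow_le_pow_left₀ h0 h1 2
        _ ≤ Z.card * ∑ x ∈ Z, b x ^ 2 := sq_sum_le_card_mul_sum_sq
        _ ≤ N * ∑ x ∈ Z, b x ^ 2 := mul_le_mul_of_nonneg_right hcard (Finset.sum_nonneg fun x _ => sq_nonneg _)
    · rw [Finset.not_nonempty_iff_eq_empty.1 hZ]
      simp
  refine (Finset.sum_le_sum hterm).trans ?_
  -- exchange the sums: `Σ_Z ‖Φ Z‖ Σ_{x∈Z} b² = Σ_{x∈Λ'} b(x)² Σ_{Z∋x} ‖Φ Z‖ ≤ S Σ b²`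
  have hex : ∑ Z ∈ Λ'.powerset, ‖Ψ.Φ Z‖ * (N * ∑ x ∈ Z, b x ^ 2) =
      N * ∑ x ∈ Λ', b x ^ 2 * ∑ Z ∈ Λ'.powerset with x ∈ Z, ‖Ψ.Φ Z‖ := by
    have e1 : ∀ Z ∈ Λ'.powerset, ‖Ψ.Φ Z‖ * (N * ∑ x ∈ Z, b x ^ 2) =
        N * ∑ x ∈ Λ', if x ∈ Z then b x ^ 2 * ‖Ψ.Φ Z‖ else 0 := by
      intro Z hZ
      rw [Finset.mem_powerset] at hZ
      rw [← Finset.sum_filter, Finset.filter_mem_eq_inter, Finset.inter_eq_right.2 hZ, Finset.mul_sum, Finset.mul_sum, Finset.mul_sum]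
      refine Finset.sum_congr rfl fun x _ => by ring
    rw [Finset.sum_congr rfl e1, ← Finset.mul_sum, Finset.sum_comm]
    congr 1
    refine Finset.sum_congr rfl fun x _ => ?_
    rw [Finset.sum_filter, Finset.mul_sum]
    refine Finset.sum_congr rfl fun Z _ => ?_
    split_ifs <;> simp
  rw [hex]
  have hin : ∀ x ∈ Λ', b x ^ 2 * ∑ Z ∈ Λ'.powerset with x ∈ Z, ‖Ψ.Φ Z‖ ≤ b x ^ 2 * S := fun x _ =>
    mul_le_mul_of_nonneg_left (hT.sum_filter_mem_norm_le hR x Λ') (sq_nonneg _)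
  calc N * ∑ x ∈ Λ', b x ^ 2 * ∑ Z ∈ Λ'.powerset with x ∈ Z, ‖Ψ.Φ Z‖ ≤ N * ∑ x ∈ Λ', b x ^ 2 * S :=
        mul_le_mul_of_nonneg_left (Finset.sum_le_sum hin) (by positivity)
    _ = N * S * ∑ x ∈ Λ', b x ^ 2 := by rw [← Finset.sum_mul]; ring

end DoubleCommutator

/-! ### §4 The criterion for a conserved on-site charge -/

section Conserved

variable (hd : 0 < d) {Ψ : FermionInteraction d} {R : ℝ} (hH : Ψ.IsHermitian) (hE : Ψ.IsEven)
  (hT : Ψ.IsTranslationInvariant) (hR : Ψ.HasFiniteRange R) {β : ℝ} (hβ : 0 ≤ β) {ω : InfVolFermionState d}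
include hd hH hE hT hR hβ

/-- **QUANTITATIVE ORDER-PARAMETER BOUND FOR A CONSERVED ON-SITE CHARGE** (the Bogoliubov–Mermin–Wagner inequality before any
limit): with `q` even Hermitian and conserved term by term, `O` of charge `κ`, ANY region `Λ₁ ⊇ Λ`, any real weights `f ≡ 1` on `Λ`,
`f ≡ 0` off `Λ₁` and any constants `c_Z`:
`|κ|²|ω(O)|² ≤ β‖O‖² · 4‖q‖² Σ_{Z ⊆ thicken Λ₁ R} ‖Φ(Z)‖ (Σ_{x∈Z}|f(x) − c_Z|)²` — the Dirichlet-type sum of `f` controls the order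
parameter of every translation-invariant solution of the variational principle. [cite: KleinLandauShucker1981] [cite: DLS1978, §2 eq. (28)] -/
theorem InfVolFermionState.IsTranslationInvariant.norm_sq_expect_le_of_conservedCharge (hω : ω.IsTranslationInvariant)
    (hS : Tendsto (fun n : ℕ => vonNeumannEntropy (ω.rdm (halfOpenBox d n)) / ((n : ℝ) ^ d)) atTop
      (𝓝 (Ψ.freePressure β + β * ω.meanEnergy Ψ R)))
    {q : FermionOp ({0} : Finset (Site d))} (hq : q.IsHermitian) (hqe : parityAut q = q)
    (hcons : ∀ Z : Finset (Site d), Commute (chargeSum q Z) (Ψ.Φ Z))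
    {Λ : Finset (Site d)} (O : FermionOp Λ) {κ : ℂ} (hO : chargeSum q Λ * O - O * chargeSum q Λ = κ • O)
    {Λ₁ : Finset (Site d)} (h₁ : Λ ⊆ Λ₁) {f : Site d → ℝ} (hf1 : ∀ x ∈ Λ, f x = 1) (hf0 : ∀ x ∉ Λ₁, f x = 0)
    (c : Finset (Site d) → ℝ) :
    ‖κ‖ ^ 2 * ‖ω.expect Λ O‖ ^ 2 ≤ β * ‖O‖ ^ 2 *
      (4 * ‖q‖ ^ 2 * ∑ Z ∈ (thicken Λ₁ R).powerset, ‖Ψ.Φ Z‖ * (∑ x ∈ Z, |f x - c Z|) ^ 2) := by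
  have hCO : weightedCharge q f Λ₁ * fermionEmbed (PolySite.incl h₁) O - fermionEmbed (PolySite.incl h₁) O * weightedCharge q f Λ₁ =
      κ • fermionEmbed (PolySite.incl h₁) O := by
    rw [weightedCharge_commutator_fermionEmbed hqe h₁ hf1 O, hO, map_smul]
  refine (hω.norm_sq_expect_le_of_double_commutator hd hH hE hT hR hβ hS h₁ le_rfl O (weightedCharge q f Λ₁) hCO).trans ?_
  refine mul_le_mul_of_nonneg_left ?_ (by positivity)
  have hW : fermionEmbed (PolySite.incl ((subset_thicken Λ₁ R).trans le_rfl)) (weightedCharge q f Λ₁) =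
      weightedCharge q f (thicken Λ₁ R) :=
    fermionEmbed_incl_weightedCharge _ fun x _ hx => hf0 x hx
  rw [hW, conjTranspose_weightedCharge hq]
  exact norm_doubleCommutator_weightedCharge_localHamiltonian_le hqe hcons _ f c

/-- **MERMIN–WAGNER CRITERION FOR A CONSERVED ON-SITE CHARGE.** Let `q ∈ 𝔄_{{0}}` be even and Hermitian, conserved by every term
of `Ψ` (`Q_Z Φ(Z) = Φ(Z) Q_Z`), and `O ∈ 𝔄_Λ` of charge `κ ≠ 0` (`Q_Λ O − O Q_Λ = κO`). Suppose that for every `ε > 0` there are a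
region `Λ₁ ⊇ Λ`, real weights `f` with `f ≡ 1` on `Λ` and `f ≡ 0` off `Λ₁`, and a modulus `b` with `|f(x) − f(y)| ≤ b(x)` for
`‖y − x‖_∞ ≤ R` and `4‖q‖² |box ⌊R⌋| S_Ψ Σ_{x ∈ thicken Λ₁ R} b(x)² ≤ ε`. Then `ω(O) = 0` for every translation-invariant solution
`ω` of the variational principle at `β ≥ 0`. [cite: KleinLandauShucker1981] [cite: ArakiMoriya2003, Theorem 12.11] -/
theorem InfVolFermionState.IsTranslationInvariant.expect_eq_zero_of_conservedCharge (hω : ω.IsTranslationInvariant)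
    (hS : Tendsto (fun n : ℕ => vonNeumannEntropy (ω.rdm (halfOpenBox d n)) / ((n : ℝ) ^ d)) atTop
      (𝓝 (Ψ.freePressure β + β * ω.meanEnergy Ψ R)))
    {q : FermionOp ({0} : Finset (Site d))} (hq : q.IsHermitian) (hqe : parityAut q = q)
    (hcons : ∀ Z : Finset (Site d), Commute (chargeSum q Z) (Ψ.Φ Z))
    {Λ : Finset (Site d)} (O : FermionOp Λ) {κ : ℂ} (hκ : κ ≠ 0) (hO : chargeSum q Λ * O - O * chargeSum q Λ = κ • O)
    (hf : ∀ ε : ℝ, 0 < ε → ∃ (Λ₁ : Finset (Site d)) (_ : Λ ⊆ Λ₁) (f b : Site d → ℝ),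
      (∀ x ∈ Λ, f x = 1) ∧ (∀ x ∉ Λ₁, f x = 0) ∧ (∀ x y : Site d, y - x ∈ box d ⌊R⌋₊ → |f x - f y| ≤ b x) ∧
      4 * ‖q‖ ^ 2 * (((box d ⌊R⌋₊).card : ℝ) * (∑ X ∈ (thicken ({0} : Finset (Site d)) R).powerset with (0 : Site d) ∈ X, ‖Ψ.Φ X‖) *
        ∑ x ∈ thicken Λ₁ R, b x ^ 2) ≤ ε) :
    ω.expect Λ O = 0 := by
  refine hω.expect_eq_zero_of_small_double_commutators hd hH hE hT hR hβ hS O hκ fun ε hε => ?_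
  obtain ⟨Λ₁, h₁, f, b, hf1, hf0, hb, hε'⟩ := hf ε hε
  refine ⟨Λ₁, h₁, thicken Λ₁ R, le_rfl, weightedCharge q f Λ₁, ?_, ?_⟩
  · rw [weightedCharge_commutator_fermionEmbed hqe h₁ hf1 O, hO, map_smul]
  · have hW : fermionEmbed (PolySite.incl ((subset_thicken Λ₁ R).trans le_rfl)) (weightedCharge q f Λ₁) =
        weightedCharge q f (thicken Λ₁ R) :=
      fermionEmbed_incl_weightedCharge _ fun x _ hx => hf0 x hx
    rw [hW, conjTranspose_weightedCharge hq]
    obtain ⟨c, hc⟩ := Ψ.sum_norm_mul_sq_sum_le hT hR (thicken Λ₁ R) hb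
    refine (norm_doubleCommutator_weightedCharge_localHamiltonian_le hqe hcons _ f c).trans (le_trans ?_ hε')
    exact mul_le_mul_of_nonneg_left hc (by positivity)

/-- **Equilibrium-state form of the criterion.** [cite: KleinLandauShucker1981] [cite: ArakiMoriya2003, Theorem 12.11] -/
theorem InfVolFermionState.IsVarEquilibrium.expect_eq_zero_of_conservedCharge (h : ω.IsVarEquilibrium β Ψ R)
    {q : FermionOp ({0} : Finset (Site d))} (hq : q.IsHermitian) (hqe : parityAut q = q)
    (hcons : ∀ Z : Finset (Site d), Commute (chargeSum q Z) (Ψ.Φ Z))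
    {Λ : Finset (Site d)} (O : FermionOp Λ) {κ : ℂ} (hκ : κ ≠ 0) (hO : chargeSum q Λ * O - O * chargeSum q Λ = κ • O)
    (hf : ∀ ε : ℝ, 0 < ε → ∃ (Λ₁ : Finset (Site d)) (_ : Λ ⊆ Λ₁) (f b : Site d → ℝ),
      (∀ x ∈ Λ, f x = 1) ∧ (∀ x ∉ Λ₁, f x = 0) ∧ (∀ x y : Site d, y - x ∈ box d ⌊R⌋₊ → |f x - f y| ≤ b x) ∧
      4 * ‖q‖ ^ 2 * (((box d ⌊R⌋₊).card : ℝ) * (∑ X ∈ (thicken ({0} : Finset (Site d)) R).powerset with (0 : Site d) ∈ X, ‖Ψ.Φ X‖) *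
        ∑ x ∈ thicken Λ₁ R, b x ^ 2) ≤ ε) :
    ω.expect Λ O = 0 :=
  h.1.expect_eq_zero_of_conservedCharge hd hH hE hT hR hβ (h.tendsto_boxEntropy_div hd hH hE hT hR hβ) hq hqe hcons O hκ hO hf

end Conserved

end Literature.MathematicalPhysics.QuantumLattice

end
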